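import Literature.MathematicalPhysics.QuantumManyBody.PeriodicMaxFormBoundHardCore
import Literature.MathematicalPhysics.QuantumManyBody.PeriodicFormDomain
import HarnessLib

/-!
# The classical debt `MaxFormBound` of crux `StaticResponseBound` is paid (item stmt-AtomisticToContinuum-12057;
# this file supports, does not close, the item)

The registered stub `stub_maxFormBound` — shared verbatim by the three skeletons of the crux
(`Cruxes/StaticResponseBound/Lines/uv-thomson-force-wave.lean` v3 (lead -0) / `uv_thomson_force_wave.lean` v4 (seat c1),
`stable_fraction_square_completion.lean` v6 (lead -2), `stable-fraction-square-completion-c2.lean` (seat c2)) and the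
hypothesis `hcore` of the landed reduction `truncationLimit_of_maxFormBound` (p77117) — is now a THEOREM of the tree:
it is literally the Literature fact `maxFormBound_of_isRepulsiveFiniteRange`
(`Literature/MathematicalPhysics/QuantumManyBody/PeriodicMaxFormBoundHardCore.lean`, prover of stmt-AtomisticToContinuum-14557):
for every repulsive finite-range `v` (hard cores included), every `N`, `L > 0` and every unit Bose-symmetric
`η ∈ L²((ℝ/ℤ)^{3N})`, the periodic ground-state energy over the `C¹` Bose core is bounded by the maximal form of `η`.
Consequently `TruncationLimit` (`E₀(min(v,n),N,L) ↑ E₀(v,N,L)`) holds unconditionally for every admissible `v`.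
-/

noncomputable section

namespace Summit.AtomisticToContinuum.BoseEinsteinCondensation.Cruxes.StaticResponseBound.FewBody

open MeasureTheory Filter UnitAddTorus
open scoped ENNReal NNReal BigOperators Topology InnerProductSpace
open Literature.MathematicalPhysics.QuantumManyBody.BoseGas

-- The measure on `ℝ/ℤ` is the Haar PROBABILITY measure, as in `PeriodicFormDomain.lean` (text of `stub_maxFormBound`).
attribute [local instance] Literature.MathematicalPhysics.QuantumManyBody.BoseGas.formDomain_measureSpace
  Literature.MathematicalPhysics.QuantumManyBody.BoseGas.formDomain_isProbabilityMeasure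
  Literature.MathematicalPhysics.QuantumManyBody.BoseGas.formDomain_isProbabilityMeasure_pi

/-- **Registered stub `stub_maxFormBound` (classical debt of crux `StaticResponseBound`), discharged:** the Bose-symmetric
periodic `C¹` core realises the infimum of the maximal hard-core form — verbatim the Literature theorem
`maxFormBound_of_isRepulsiveFiniteRange`. [cite: ReedSimonIV1978, Thm. XIII.64; Simon1979Forms] -/
theorem stub_maxFormBound :
    ∀ v : ℝ → ℝ≥0∞, IsRepulsiveFiniteRange v → ∀ (N : ℕ) (L : ℝ), 0 < L →
      ∀ η : Lp ℂ 2 (volume : Measure (UnitAddTorus (Fin N × Fin 3))), ‖η‖ = 1 →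
        (∀ (σ : Equiv.Perm (Fin N)) (n : Fin N × Fin 3 → ℤ),
          ⟪(mFourierLp 2 (fun p : Fin N × Fin 3 => n (σ p.1, p.2)) :
              Lp ℂ 2 (volume : Measure (UnitAddTorus (Fin N × Fin 3)))), η⟫_ℂ =
            ⟪(mFourierLp 2 n : Lp ℂ 2 (volume : Measure (UnitAddTorus (Fin N × Fin 3)))), η⟫_ℂ) →
        periodicGroundStateEnergy v N L ≤
          ∑' n : Fin N × Fin 3 → ℤ, ENNReal.ofReal (∑ p, (2 * Real.pi * (n p : ℝ) / L) ^ 2) *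
              (‖⟪(mFourierLp 2 n : Lp ℂ 2 (volume : Measure (UnitAddTorus (Fin N × Fin 3)))), η⟫_ℂ‖₊ :
                ℝ≥0∞) ^ 2 +
            ∫⁻ t, periodicInteraction v L (fromUnitTorusN L t) *
              (‖(η : UnitAddTorus (Fin N × Fin 3) → ℂ) t‖₊ : ℝ≥0∞) ^ 2 :=
  maxFormBound_of_isRepulsiveFiniteRange

end Summit.AtomisticToContinuum.BoseEinsteinCondensation.Cruxes.StaticResponseBound.FewBody

end
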